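import Summits.BirchSwinnertonDyer.Rank1Residual.ManinAdditive.UDCKummerLineK
import Summits.BirchSwinnertonDyer.Rank1Residual.ManinAdditive.CuspidalKummerCubeLaws
import HarnessLib
import HarnessLib.Audit.Tags

/-!
# SCRATCH (cell bsd-f2-manin, -an g39-b, file F): THE SHIMURA STRATUM OF RES₃♭ IS EMPTY IF A SHIMURA `3`-KERNEL FORCES RATIONAL `3`-TORSION
# — E-an-221 `ShimuraThreeKernelForcesRationalThreeTorsionAtNine` and the PROVED net
# RES₃♭ ⟸ EXISTC ∧ (BI)_K ∧ (AN)_K ∧ E-an-221  (four pieces; GENΣ, E-an-201(R), RESΣ, E-an-212/214 all bypassed)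

Route `ManinLocalTwoThree`, crux C3 `ManinPrimeToThreeAtNine` (stmt-BirchSwinnertonDyer-22968), sub-target RES₃♭
`CuspidalKummerThree.NoRationalThreeTorsionCoprimeIsolatedResidual`.  PART A (statement side, to land as
`Summits/BirchSwinnertonDyer/Rank1Residual/ManinAdditive/ShimuraThreeTorsion.lean`) + PART B (Theorems side, namespace
`…Theorems.ManinLocalTwoThree`, to land as `Theorems/ManinLocalTwoThreeShimuraThreeTorsionAtNine.lean`; imports only LANDED modules:
`UDCKummerLineK` p734676, `Theorems/ManinLocalTwoThreeUDCLineKAtNine` p735594).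

THE OBSERVATION (MEMO-an §83.11).  RES₃♭ carries the hypothesis «no rational point of order 3 on `E_{W,c}`».  In the landed split
(`noRationalThreeTorsionCoprimeIsolatedResidual_of_kLine`, file A) the lifted `K`-point `T` either has a NON-Shimura Kummer class — the
UDC/K-line KLINE♮ ⟸ NCΣ (PROVED) ∧ (BI)_K ∧ (AN)_K handles it — or `φ₀^*T ∈ Σ(N)` (`KummerShimura D u`), where the landed split needs
GENΣ (generic kernels) and RESΣ (= Manin on the `μ₃`-Shimura stratum, OPEN, no mechanism).  But on an `X₀(N)`-OPTIMAL curve a Shimura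
kernel of order 3 seems to FORCE A RATIONAL POINT OF ORDER 3 — so under RES₃♭'s own hypothesis the Shimura branch is EMPTY, for generic
and `μ`-type kernels alike:

* E-an-221 `ShimuraThreeKernelForcesRationalThreeTorsionAtNine`: lattice-optimal `D`, `9 ∣ N`, `u ∉ Λ`, `3u ∈ Λ`, `KummerShimura D u`
  (every `γ ∈ Γ₁(N)` has trivial Kummer period along `u`, i.e. `Λ₁(f) ⊆ ℤ·(3u/c) + 3Λ₀(f)`, i.e. `3 ∣ #(E₀ ∩ Σ(N))` with `c·u/…` in the
  kernel) ⟹ `E_{W,c}` has a rational point of order 3.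
  MECHANISM (heuristic, the Shimura/cuspidal duality): `E₀ ∩ Σ(N)` is `μ`-type [LO91 Thm 1] and Cartier-dual to a constant quotient; for
  PRIME `N` Mazur's theorem gives `#(E₀ ∩ Σ) = #(E₀ ∩ C) = n = num((N−1)/12)` for the Eisenstein optimal quotient, so `E₀(ℚ) ⊇ ℤ/n`
  whenever `E₀ ∩ Σ ≅ μ_n` (11a1: `E₀[5] = C ⊕ Σ = ℤ/5 ⊕ μ₅`).  EVIDENCE: (i) -ref1 §R182 `shimura_index.py` (HOME/ref1/e182/): for the 112
  optimal classes `9 ∣ N ≤ 386`, `[Λ₀(f) : Λ₁(f)] ≠ 1` exactly for 27a1, 54a1 (index 3) — both have `E₀(ℚ)_tors = ℤ/3`; (ii) calibration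
  over all `N` (ref1's table + Cremona): `[Λ₀ : Λ₁] = n > 1` at 11a (5), 14a (3), 15a (4), 17a (4), 19a (3), 20a (2), 27a (3), 32a (2),
  54a (3), 64a (2) and `#E₀(ℚ)_tors` = 5, 6, 8, 4, 3, 6, 3, 4, 3, 4: **`n ∣ #E₀(ℚ)_tors` in 10/10**; (iii) consistent with the censuses of
  §82–§83: 688/688 RES₃♭ classes `N < 10⁵` are NOT Shimura (D-an-22-lite), and the only optimal `μ₃`-carriers of star type below `5·10⁵`
  are 27a1, 54a1 (E-an-214 census 9 970/9 970).  NOT Manin-implied (it is a statement about `Σ(N) ∩ E₀` versus `E₀(ℚ)_tors`); the general-`N`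
  form «`[Λ₀(f) : Λ₁(f)]` divides `#E₀(ℚ)_tors`» is recorded as E-an-221♯ in MEMO-an §83.11 (informal; Stevens-1989-type).
* PROVED (PART B): `noRationalThreeTorsionCoprimeIsolatedResidual_of_kLine_sigmaTorsion : EXISTC → KLINE♮ → E-an-221 → RES₃♭` and
  `…_of_kPieces_sigmaTorsion : EXISTC → (BI)_K → (AN)_K → E-an-221 → RES₃♭` (with the landed `nonShimuraThreeTorsionCaseAtNineGermFree_of_pieces`,
  NCΣ proved inside); `…_udc` variant with (AN♮)_K + UDC (all weights).

HONEST FRAMING: E-an-221 is a `@[conjecture]` cell candidate with a finite census (i)–(iii) and a prime-level theorem behind it (Mazur);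
its cheapest falsifier is an optimal curve with `9 ∣ N`, `3 ∣ [Λ₀(f) : Λ₁(f)]` and `E₀(ℚ)[3] = 0` (ask R-an-77: extend `shimura_index.py` to the
optimal 3B.1.2 curves `9 ∣ N ≤ 5000`).  Nothing here proves RES₃♭, C3, Manin's conjecture or BSD.
PARTITION 0 · beyond-print theorem: no · BSD is not proved by this.
[cite: LingOesterle1991, Thm. 1] [cite: Mazur1977, Thm. II.11.6 and Prop. II.11.7 (Shimura and cuspidal subgroups of order n)]
[cite: Vatsal2005, §1 Rem. 1.8 and Conj. 1.9] [cite: Stevens1989, §2]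

TYPER NOTE (typer g21, T-an-49 part 1).  SOURCE = HOME/an/g39/ShimuraThreeTorsion-an-g39.lean (file F) sha16 3b4b01ee452301e0 (122 l.; an: farm
rc 0 · 0 · 0, std axioms, BC7 CLEAN g39-bc7-f) — this tree file is file F's **PART A** VERBATIM (the one `@[conjecture]` decl below, an's own
tag, body untouched) with the module docstring kept as an wrote it; typer deltas: (i) the import of
`…Theorems.ManinLocalTwoThreeUDCLineKAtNine` (p735594 — inside the `Theses.ManinLocalTwoThree` cone) is DROPPED together with PART B, which is
a PROVER-ONLY target (`Theorems/ManinLocalTwoThreeShimuraThreeTorsionAtNine.lean`, L-an-g39-3: `noRationalThreeTorsionCoprimeIsolatedResidual_of_kLine_sigmaTorsion`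
EXISTC → KLINE♮ → E-an-221 → RES₃♭ and the `_of_kPieces_sigmaTorsion[_udc]` nets); (ii) `set_option linter.dupNamespace false` dropped (only
the Theorems namespace needed it; lint debt otherwise).  Imports: `…ManinAdditive.UDCKummerLineK` (p734676) + `…ManinAdditive.CuspidalKummerCubeLaws`
+ HarnessLib(+Audit.Tags) — route-independent, namespace `…ManinAdditive.ShimuraThreeTorsion`.  ROW **E-an-221
`ShimuraThreeKernelForcesRationalThreeTorsionAtNine`** (an MEMO-an §83.11, HOME/an/MEMO-an-83.md 8fd72ed6c4a6bcf3): lattice-optimal D, 9 ∣ N,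
u ∉ Λ, 3u ∈ Λ, `KummerShimura D u` ⟹ the short model has a RATIONAL point of order 3 — so under RES₃♭'s own hypothesis the Shimura branch is
EMPTY and RES₃♭ ⟸ EXISTC ∧ (BI)_K ∧ (AN)_K ∧ E-an-221 (PART B, Theorems side).  NOT IN PRINT at composite level (prime level: Mazur 1977
Prop. II.11.7 Shimura/cuspidal duality; general-N form E-an-221♯ «[Λ₀(f) : Λ₁(f)] ∣ #E₀(ℚ)_tors» informal, F-an-14 asks whether it is in
print).  BC5 (ref1 §R182 engine shimura_index.py HOME/ref1/e182/ + Cremona): 112 optimal classes 9 ∣ N ≤ 386 — `[Λ₀ : Λ₁] ≠ 1` exactly for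
27a1, 54a1 (index 3), both with E₀(ℚ)_tors = ℤ/3; all-N calibration `[Λ₀ : Λ₁] ∣ #E₀(ℚ)_tors` 10/10 (11a … 64a); consistent with 688/688
RES₃♭ classes N < 10⁵ not Shimura and E-an-214's census (optimal star μ₃-carriers = {27a1, 54a1}); 0 violations.  CHEAPEST FALSIFIER: an
optimal curve with 9 ∣ N, 3 ∣ [Λ₀(f) : Λ₁(f)] and E₀(ℚ)[3] = 0 (R-an-77: extend shimura_index.py to the optimal 3B.1.2 curves 9 ∣ N ≤ 5000).
REFUTER: ref1 R-an-77 PENDING at landing; ref2 / F-an-14 PENDING.  Typer checks: decl name fresh tree-wide; cite keys LingOesterle1991 /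
Mazur1977 / Vatsal2005 / Stevens1989 in references.bib; no instances, no notation.  PARTITION 0 · beyond-print theorem: no · bears_on:
stmt-BirchSwinnertonDyer-22968 (C3).  BSD is not proved by this; Manin `c = 1` is not proved by this; C3 OPEN.
-/

set_option autoImplicit false

noncomputable section

open scoped Classical
open WeierstrassCurve Literature.NumberTheory.EllipticCurves Literature.NumberTheory.EllipticCurves.ModularForms
open Summit.BirchSwinnertonDyer.Rank1Residual.ManinAdditive.CuspidalKummer
open Summit.BirchSwinnertonDyer.Rank1Residual.ManinAdditive.CuspidalKummerThree
open Summit.BirchSwinnertonDyer.Rank1Residual.ManinAdditive.UDCKummerLine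
open Summit.BirchSwinnertonDyer.Rank1Residual.ManinAdditive.UDCKummerLineK

/-! ## PART A — statement side (to land as `…/ManinAdditive/ShimuraThreeTorsion.lean`) -/

namespace Summit.BirchSwinnertonDyer.Rank1Residual.ManinAdditive.ShimuraThreeTorsion

/-- **E-an-221 `ShimuraThreeKernelForcesRationalThreeTorsionAtNine` (cell bsd-f2-manin MEMO-an §83.11; candidate law, nothing asserted).**
For a lattice-optimal datum `D` of a globally minimal `W` at level `N` with `9 ∣ N`: if `u ∉ Λ`, `3u ∈ Λ` (`Λ = D.L.lattice = cΛ₀(f)`) and every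
`γ ∈ Γ₁(N)` has trivial Kummer period along `u` (`KummerShimura D u`: the point `P = (c²℘(u), c³℘′(u)/2)` of order 3 spans a subgroup of
`E₀ ∩ Σ(N)`), then the short model `E_{W,c}` has a RATIONAL point of order 3.  Mechanism: `Σ(N)` is of `μ`-type (Ling–Oesterlé) and the
Shimura / cuspidal intersections with `E₀` are dual (Mazur at prime level: both of order `n`); census: `9 ∣ N ≤ 386` only 27a1, 54a1 have
`3 ∣ [Λ₀(f) : Λ₁(f)]`, both with `E₀(ℚ)_tors = ℤ/3`; all-`N` calibration `[Λ₀ : Λ₁] ∣ #E₀(ℚ)_tors` 10/10 (11a … 64a).  Why it might fail: an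
optimal curve with `9 ∣ N > 386`, `3 ∣ #(E₀ ∩ Σ)` and no rational 3-torsion (none known; a non-split 3B.1.2 optimal curve of star Kodaira
type would be one — none below `5·10⁵`). [cite: LingOesterle1991, Thm. 1] [cite: Mazur1977, Prop. II.11.7] [cite: Vatsal2005, §1 Rem. 1.8] -/
@[conjecture]
def ShimuraThreeKernelForcesRationalThreeTorsionAtNine : Prop :=
  ∀ (W : WeierstrassCurve ℚ) [W.IsElliptic] [W.IsGloballyMinimal] {N : ℕ} [NeZero N]
    (D : ModularParametrizationData W N),
    (∀ z ∈ D.L.lattice, ∃ w ∈ periodLattice D.f, z = D.c * w) → 3 ^ 2 ∣ N →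
    ∀ u : ℂ, u ∉ D.L.lattice → 3 * u ∈ D.L.lattice → KummerShimura D u →
    ∃ X Y : ℚ, IsShortThreeTorsion W D.c X Y

end Summit.BirchSwinnertonDyer.Rank1Residual.ManinAdditive.ShimuraThreeTorsion

end
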